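import Summits.QuantumAdvantage.QuantumAdvantage.Theorems.CharDialPlaneDivAscentC2
import HarnessLib

/-!
# HyperplaneLemma — PART C3 of PlaneDivAscent (continuation of Parts C1/C2; see C1's module docstring)
(cell decomp-qadv, lens 6, g21 REV2; tree-ready, Prop-definition-free.)  §4 the sheared two-variable lemma
`hl2_gen`; §5 the abstract hyperplane lemma `hl_abstract` for every finite `𝔽_p`-module (kernel counting
`card_ker_mul`, a pair `(u, w)` avoiding all kernels `exists_pair_avoiding`, pull-back to a plane).
-/

set_option autoImplicit false

namespace Summit.QuantumAdvantage.AdviceFreeQNC0.PlaneDiv.HL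

open Polynomial Finset

variable {p : ℕ} [Fact p.Prime]

/-- **HL(2), general lines.** `G` on `𝔽_p²` with all line sums zero, vanishing on `p - 1`
pairwise non-proportional lines `α_i a + α'_i b = γ_i`, is identically zero. -/
theorem hl2_gen (G : ZMod p → ZMod p → ZMod p)
    (hls : ∀ a₀ b₀ a₁ b₁ : ZMod p, ∑ t : ZMod p, G (a₀ + t * a₁) (b₀ + t * b₁) = 0)
    (α α' γ : Fin (p - 1) → ZMod p) (hnz : ∀ i, α i ≠ 0 ∨ α' i ≠ 0)
    (hnp : ∀ i j, i ≠ j → ∀ l : ZMod p, ¬ (α j = l * α i ∧ α' j = l * α' i ∧ γ j = l * γ i))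
    (hvan : ∀ i a b, α i * a + α' i * b = γ i → G a b = 0) : ∀ a b, G a b = 0 := by
  classical
  have hp2 : 2 ≤ p := (Fact.out : p.Prime).two_le
  -- a good shear parameter s with α i * s + α' i ≠ 0 for all i
  obtain ⟨s, hs⟩ : ∃ s : ZMod p, ∀ i, α i * s + α' i ≠ 0 := by
    let bad : Finset (ZMod p) :=
      Finset.univ.biUnion fun i : Fin (p - 1) => Finset.univ.filter fun s => α i * s + α' i = 0
    have hone : ∀ i ∈ (Finset.univ : Finset (Fin (p - 1))),
        (Finset.univ.filter fun s : ZMod p => α i * s + α' i = 0).card ≤ 1 := by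
      intro i _
      refine Finset.card_le_one.mpr ?_
      intro s hs s' hs'
      simp only [mem_filter, mem_univ, true_and] at hs hs'
      rcases eq_or_ne (α i) 0 with h0 | h0
      · exfalso
        have h1 : α' i = 0 := by rw [h0, zero_mul, zero_add] at hs; exact hs
        rcases hnz i with h | h
        · exact h h0
        · exact h h1
      · have : α i * (s - s') = 0 := by
          rw [mul_sub, sub_eq_zero]
          have e1 := hs; have e2 := hs'
          rw [← sub_eq_zero] 
          linear_combination e1 - e2
        rcases mul_eq_zero.mp this with h' | h'
        · exact absurd h' h0
        · exact sub_eq_zero.mp h'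
    have hbad : bad.card ≤ p - 1 := by
      calc bad.card ≤ ∑ i : Fin (p - 1),
            (Finset.univ.filter fun s : ZMod p => α i * s + α' i = 0).card := card_biUnion_le
        _ ≤ ∑ _i : Fin (p - 1), 1 := sum_le_sum hone
        _ = p - 1 := by simp
    have hlt : bad.card < (Finset.univ : Finset (ZMod p)).card := by
      rw [card_univ, ZMod.card]; omega
    obtain ⟨s, _, hs⟩ := exists_mem_notMem_of_card_lt_card hlt
    refine ⟨s, fun i h => hs ?_⟩
    exact mem_biUnion.mpr ⟨i, mem_univ _, mem_filter.mpr ⟨mem_univ _, h⟩⟩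
  -- sheared function
  set G' : ZMod p → ZMod p → ZMod p := fun a b => G (a + s * b) b with hG'def
  have hls' : ∀ c l : ZMod p, ∑ t : ZMod p, G' t (c + l * t) = 0 := by
    intro c l
    have h := hls (s * c) c (1 + s * l) l
    rw [← h]
    refine sum_congr rfl fun t _ => ?_
    simp only [hG'def]
    congr 1 <;> ring
  -- the lines in slope form
  set d : Fin (p - 1) → ZMod p := fun i => α i * s + α' i with hddef
  have hd : ∀ i, d i ≠ 0 := hs
  set L : Fin (p - 1) → ZMod p × ZMod p := fun i => (γ i / d i, -α i / d i) with hLdef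
  have hL : Function.Injective L := by
    intro i j hij
    by_contra hne
    simp only [hLdef, Prod.mk.injEq] at hij
    obtain ⟨h1, h2⟩ := hij
    have hdi := hd i; have hdj := hd j
    rw [div_eq_div_iff hdi hdj] at h1 h2
    have key : α i * d j = α j * d i := by linear_combination -h2
    have key2 : α i * α' j = α j * α' i := by
      simp only [hddef] at key; linear_combination key
    apply hnp i j hne (d j / d i)
    refine ⟨?_, ?_, ?_⟩
    · rw [div_mul_eq_mul_div, eq_div_iff hdi]
      linear_combination -key
    · rw [div_mul_eq_mul_div, eq_div_iff hdi]
      simp only [hddef]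
      linear_combination s * key2
    · rw [div_mul_eq_mul_div, eq_div_iff hdi]
      linear_combination -h1
  have hvan' : ∀ i a, G' a ((L i).1 + (L i).2 * a) = 0 := by
    intro i a
    simp only [hG'def, hLdef]
    apply hvan i
    have hdi := hd i
    simp only [hddef] at hdi ⊢
    field_simp
    ring
  have hzero := hl2_coord G' hls' L hL hvan'
  intro a b
  have := hzero (a - s * b) b
  simp only [hG'def] at this
  rwa [sub_add_cancel] at this

end Summit.QuantumAdvantage.AdviceFreeQNC0.PlaneDiv.HL

namespace Summit.QuantumAdvantage.AdviceFreeQNC0.PlaneDiv.HL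

open Finset

variable {p : ℕ} [Fact p.Prime]

section Abstract

variable {M : Type*} [AddCommGroup M] [Module (ZMod p) M] [Fintype M] [DecidableEq M]

/-- The kernel of a nonzero functional has exactly `|M| / p` elements. -/
theorem card_ker_mul (θ : M →ₗ[ZMod p] ZMod p) (hθ : θ ≠ 0) :
    p * (Finset.univ.filter fun u : M => θ u = 0).card = Fintype.card M := by
  classical
  obtain ⟨u₁, hu₁⟩ : ∃ u₁, θ u₁ ≠ 0 := by
    by_contra h
    simp only [not_exists, not_not] at h
    exact hθ (LinearMap.ext h)
  have hfib : ∀ c : ZMod p, (univ.filter fun u : M => θ u = c).card =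
      (univ.filter fun u : M => θ u = 0).card := by
    intro c
    have hset : (univ.filter fun u : M => θ u = c) =
        (univ.filter fun u : M => θ u = 0).image (fun u => u + (c / θ u₁) • u₁) := by
      ext u
      simp only [mem_filter, mem_univ, true_and, mem_image]
      constructor
      · intro hu
        refine ⟨u - (c / θ u₁) • u₁, ?_, by abel⟩
        rw [map_sub, map_smul, smul_eq_mul, hu, div_mul_cancel₀ _ hu₁, sub_self]
      · rintro ⟨v, hv, rfl⟩
        rw [map_add, map_smul, smul_eq_mul, hv, div_mul_cancel₀ _ hu₁, zero_add]
    rw [hset, card_image_of_injective _ (add_left_injective _)]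
  have hsum := Finset.card_eq_sum_card_fiberwise (s := (univ : Finset M))
    (t := (univ : Finset (ZMod p))) (f := fun u => θ u) (fun u _ => mem_univ _)
  rw [card_univ] at hsum
  rw [hsum]
  simp_rw [hfib]
  rw [sum_const, card_univ, ZMod.card, smul_eq_mul]

/-- Selection: for fewer than `p²` nonzero functionals there are `u, w` such that no
functional kills both. -/
theorem exists_pair_avoiding {J : Type*} [Fintype J] (θ : J → (M →ₗ[ZMod p] ZMod p))
    (hθ : ∀ k, θ k ≠ 0) (hJ : Fintype.card J < p * p) :
    ∃ u w : M, ∀ k, θ k u ≠ 0 ∨ θ k w ≠ 0 := by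
  classical
  have hp : 0 < p := (Fact.out : p.Prime).pos
  have hM : 0 < Fintype.card M := Fintype.card_pos
  set T : J → ℕ := fun k => (univ.filter fun u : M => θ k u = 0).card with hTdef
  have hT : ∀ k, p * T k = Fintype.card M := fun k => card_ker_mul (θ k) (hθ k)
  have hdc : ∑ u : M, (univ.filter fun k : J => θ k u = 0).card = ∑ k : J, T k := by
    simp only [hTdef, Finset.card_filter]
    exact Finset.sum_comm
  obtain ⟨u, hu⟩ : ∃ u : M, (univ.filter fun k : J => θ k u = 0).card < p := by
    by_contra hcon
    simp only [not_exists, not_lt] at hcon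
    have h1 : p * Fintype.card M ≤ ∑ u : M, (univ.filter fun k : J => θ k u = 0).card := by
      calc p * Fintype.card M = ∑ _u : M, p := by
            rw [sum_const, card_univ, smul_eq_mul, mul_comm]
        _ ≤ _ := sum_le_sum fun u _ => hcon u
    have h2 : p * ∑ k : J, T k = Fintype.card J * Fintype.card M := by
      rw [mul_sum]; simp_rw [hT]; rw [sum_const, card_univ, smul_eq_mul]
    rw [hdc] at h1
    have h3 : p * (p * Fintype.card M) ≤ Fintype.card J * Fintype.card M := by
      rw [← h2]; exact Nat.mul_le_mul_left _ h1
    have h4 : Fintype.card J * Fintype.card M < p * p * Fintype.card M :=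
      Nat.mul_lt_mul_of_pos_right hJ hM
    have : p * (p * Fintype.card M) = p * p * Fintype.card M := by ring
    omega
  set K := univ.filter fun k : J => θ k u = 0 with hKdef
  have hunion : (K.biUnion fun k => univ.filter fun w : M => θ k w = 0).card <
      (univ : Finset M).card := by
    have h1 : (K.biUnion fun k => univ.filter fun w : M => θ k w = 0).card ≤ ∑ k ∈ K, T k :=
      card_biUnion_le
    have h2 : p * ∑ k ∈ K, T k = K.card * Fintype.card M := by
      rw [mul_sum]; simp_rw [hT]; rw [sum_const, smul_eq_mul]
    have h3 : K.card * Fintype.card M < p * Fintype.card M := Nat.mul_lt_mul_of_pos_right hu hM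
    rw [card_univ]
    have h4 : p * (K.biUnion fun k => univ.filter fun w : M => θ k w = 0).card <
        p * Fintype.card M := by
      calc _ ≤ p * ∑ k ∈ K, T k := Nat.mul_le_mul_left _ h1
        _ = K.card * Fintype.card M := h2
        _ < p * Fintype.card M := h3
    exact Nat.lt_of_mul_lt_mul_left h4
  obtain ⟨w, _, hw⟩ := exists_mem_notMem_of_card_lt_card hunion
  refine ⟨u, w, fun k => ?_⟩
  by_cases hk : θ k u = 0
  · right
    intro hkw
    apply hw
    exact mem_biUnion.mpr ⟨k, mem_filter.mpr ⟨mem_univ _, hk⟩, mem_filter.mpr ⟨mem_univ _, hkw⟩⟩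
  · exact Or.inl hk

end Abstract

/-- **The hyperplane lemma (all finite-dimensional `𝔽_p`-spaces).** -/
theorem hl_abstract (M : Type*) [AddCommGroup M] [Module (ZMod p) M]
    [Module.Finite (ZMod p) M] (g : M → ZMod p)
    (hg : ∀ y v : M, ∑ t : ZMod p, g (y + t • v) = 0)
    (φ : Fin (p - 1) → (M →ₗ[ZMod p] ZMod p)) (c : Fin (p - 1) → ZMod p)
    (hφ : ∀ i, φ i ≠ 0)
    (hnp : ∀ i j, i ≠ j → ∀ l : ZMod p, ¬ (φ j = l • φ i ∧ c j = l * c i))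
    (hvan : ∀ i, ∀ x, φ i x = c i → g x = 0) : ∀ x, g x = 0 := by
  classical
  haveI : Finite M := Module.finite_of_finite (ZMod p)
  letI : Fintype M := Fintype.ofFinite M
  have hp2 : 2 ≤ p := (Fact.out : p.Prime).two_le
  intro x
  by_cases hx : ∃ i, φ i x = c i
  · obtain ⟨i, hi⟩ := hx; exact hvan i x hi
  simp only [not_exists] at hx
  set b : Fin (p - 1) → ZMod p := fun i => c i - φ i x with hbdef
  have hb : ∀ i, b i ≠ 0 := fun i h => hx i (by
    have : c i - φ i x = 0 := h
    exact (sub_eq_zero.mp this).symm)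
  -- the family of functionals to avoid
  let J := Fin (p - 1) ⊕ {q : Fin (p - 1) × Fin (p - 1) // q.1 ≠ q.2}
  let θ : J → (M →ₗ[ZMod p] ZMod p) :=
    Sum.elim (fun i => φ i) (fun q => b q.1.1 • φ q.1.2 - b q.1.2 • φ q.1.1)
  have hθ : ∀ k, θ k ≠ 0 := by
    rintro (i | ⟨⟨i, j⟩, hij⟩)
    · exact hφ i
    · simp only [θ, Sum.elim_inr, ne_eq] at hij ⊢
      intro h0
      have h0' : b i • φ j = b j • φ i := sub_eq_zero.mp h0
      apply hnp i j hij (b j / b i)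
      have hφj : φ j = (b j / b i) • φ i := by
        rw [div_eq_mul_inv, mul_comm, ← smul_smul, ← h0', smul_smul, inv_mul_cancel₀ (hb i),
          one_smul]
      refine ⟨hφj, ?_⟩
      have e1 : b i * φ j x = b j * φ i x := by
        have := congrArg (fun ψ : M →ₗ[ZMod p] ZMod p => ψ x) h0'
        simpa using this
      rw [div_mul_eq_mul_div, eq_div_iff (hb i)]
      simp only [hbdef] at e1 ⊢
      linear_combination e1
  have hJ : Fintype.card J < p * p := by
    have h1 : Fintype.card {q : Fin (p - 1) × Fin (p - 1) // q.1 ≠ q.2} ≤ (p - 1) * (p - 1) := by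
      calc _ ≤ Fintype.card (Fin (p - 1) × Fin (p - 1)) := Fintype.card_subtype_le _
        _ = (p - 1) * (p - 1) := by simp [Fintype.card_prod]
    have h2 : Fintype.card J =
        (p - 1) + Fintype.card {q : Fin (p - 1) × Fin (p - 1) // q.1 ≠ q.2} := by
      simp only [J, Fintype.card_sum, Fintype.card_fin]
    rw [h2]
    have h3 : (p - 1) + (p - 1) * (p - 1) = (p - 1) * p := by
      zify [hp2, (by omega : 1 ≤ p)]; ring
    have h4 : (p - 1) * p < p * p := Nat.mul_lt_mul_of_pos_right (by omega) (by omega)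
    omega
  obtain ⟨u, w, huw⟩ := exists_pair_avoiding θ hθ hJ
  -- pull back to the coordinate plane through x spanned by u, w
  have hG := hl2_gen (p := p) (fun a b' => g (x + a • u + b' • w)) ?_ (fun i => φ i u)
    (fun i => φ i w) b ?_ ?_ ?_
  · have := hG 0 0; simpa using this
  · intro a₀ b₀ a₁ b₁
    have h := hg (x + a₀ • u + b₀ • w) (a₁ • u + b₁ • w)
    rw [← h]
    refine sum_congr rfl fun t _ => ?_
    simp only [add_smul, mul_smul, smul_add]
    abel_nf
  · intro i
    rcases huw (Sum.inl i) with h | h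
    · exact Or.inl h
    · exact Or.inr h
  · rintro i j hij l ⟨h1, h2, h3⟩
    rcases huw (Sum.inr ⟨(i, j), hij⟩) with h | h
    · apply h
      simp only [θ, Sum.elim_inr, LinearMap.sub_apply, LinearMap.smul_apply, smul_eq_mul, h1, h3]
      ring
    · apply h
      simp only [θ, Sum.elim_inr, LinearMap.sub_apply, LinearMap.smul_apply, smul_eq_mul, h2, h3]
      ring
  · intro i a b' hab
    apply hvan i
    simp only [map_add, map_smul, smul_eq_mul]
    simp only [hbdef] at hab
    linear_combination hab

end Summit.QuantumAdvantage.AdviceFreeQNC0.PlaneDiv.HL
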